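import Summits.CriticalPhenomena.SAWScalingLimit.Theses.SAWFrontierHomotopy
import Summits.CriticalPhenomena.SAWScalingLimit.Theorems.SAWFrontierHomotopyOneSidedPowerLawExponentRigidity
import Literature.Probability.RandomPlanarGeometry.LoewnerSemigroup
import Literature.Probability.RandomPlanarGeometry.RestrictionExponent
import Literature.Probability.RandomPlanarGeometry.ConformalRectangleProofs
import Literature.Probability.RandomPlanarGeometry.HullSubdomainPullback
import Literature.Probability.RandomPlanarGeometry.RestrictionHullsRiemannProofs
import Literature.Probability.RandomPlanarGeometry.RestrictionHullsProofs
import Literature.Probability.RandomPlanarGeometry.CaratheodoryHalfPlaneProofs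
import HarnessLib

/-!
# Negative knowledge on crux `OneSidedPowerLaw` (stmt-CriticalPhenomena-10702), part 5:
# the conformal data of the crux are canonical

Support file (line lead c4, route SAWFrontierHomotopy) for the crux
`Summit.CriticalPhenomena.SAWScalingLimit.Theses.SAWFrontierHomotopy.OneSidedPowerLaw`: "ONE exponent `α` such that
for every Dobrushin domain `(D; a, b)`, endpoint approximation, hull subdomain `D'`, chordal uniformizer `φ` whose
pulled-back hull `A = closure (ℍ ∖ φ⁻¹ D')` is a plus- OR minus-hull, and restriction data `(Φ, d = Φ'_A(0))`,
`P_δ[range γ_δ ⊆ closure D'] → d ^ α`". The body quantifies UNIVERSALLY over the conformal data `(φ, Φ, d)`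
while the lattice quantity on the left depends on `(D, D', a, b)` only; so the crux (whose exponent is `> 0`
whenever its body holds, part 3) would be refuted by pure conformal geometry — no SAW input — if two
admissible data of one configuration could carry different numbers `d₁ ≠ d₂`, and the same witness would
refute the conjunct `SAWScalingLimit` through `not_sawScalingLimit_of_not_oneSidedPowerLaw` (part 4). This
file closes that avenue, kernel-checked:

* `setOf_mem_eq_smul`, `hull_eq_smul` — two chordal uniformizers differ by a dilation `φ₂ = φ₁ ∘ (c ·)`
  (`IsChordalUniformizing.exists_eq_trans_smul_holds`), so the pulled-back hulls differ by the dilation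
  `A₂ = c⁻¹ A₁`;
* `isPlusHull_smul_iff`, `isMinusHull_smul_iff` — dilations preserve the side of a hull (tree: `IsPlusHull.smul`);
* `restrictionDeriv_eq_of_eq_smul` — `Φ'_{cA}(0) = Φ'_A(0)` for ANY restriction data of `A` and of
  `c A` (the tree's `HasRestrictionDeriv.smulHull` for the transported map, plus uniqueness of
  restriction maps `IsStarHull.existsUnique_isRestrictionMap_holds` and of the derivative);
* `stub_datumCanonical` — hence for fixed `(D, D')` all admissible data have the SAME side and the SAME
  `d`: the conclusion of the crux body does not depend on the datum it is evaluated at;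
* `oneSidedPowerLawExp_iff_exists_datum` — consequently the crux body at exponent `α` is equivalent to its
  form with the restriction data quantified EXISTENTIALLY (`∃ Φ d` instead of `∀ Φ d`; existence by
  `IsStarHull.existsUnique_isRestrictionMap_holds` / `IsStarHull.exists_hasRestrictionDeriv_holds`), and
  `OneSidedPowerLawExp.tendsto_of_tendsto` transports the conclusion between any two uniformizers.

Moral for the line: the `∀ (φ, Φ, d)` of the crux is inessential bookkeeping (the target value is the
intrinsic number `d(D, D')`); together with parts 1–4, every quantifier of the crux except the lattice ones
(`D`, `D'`, the endpoint approximation) has now been discharged or rigidified by soft means. [folklore]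
-/

noncomputable section

open Set Filter Topology MeasureTheory Complex Metric
open scoped Pointwise ENNReal NNReal
open UpperHalfPlane (upperHalfPlaneSet isOpen_upperHalfPlaneSet)
open Literature.Probability.RandomPlanarGeometry Literature.Probability.LatticeModels
open Summit.CriticalPhenomena.SAWScalingLimit.Theses.SAWFrontierHomotopy (OneSidedPowerLaw)

namespace Summit.CriticalPhenomena.SAWScalingLimit.Theorems.OneSidedPowerLaw.Negative

/-! ### Dilations of pulled-back hulls -/

section Smul

variable {D D' : DobrushinDomain} {φ₁ φ₂ : ConformalEquiv upperHalfPlaneSet D.carrier} {c : ℝ}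

/-- If `φ₂ = φ₁ ∘ (c ·)` on `ℍ` then `φ₂⁻¹ D' = c⁻¹ · φ₁⁻¹ D'` (as subsets of `ℍ`). [folklore] -/
theorem setOf_mem_eq_smul (hc : 0 < c)
    (h : EqOn φ₂ ((ConformalEquiv.smulUpperHalfPlane c hc).trans φ₁) upperHalfPlaneSet) :
    {z : ℂ | z ∈ upperHalfPlaneSet ∧ φ₂ z ∈ D'.carrier} =
      c⁻¹ • {z : ℂ | z ∈ upperHalfPlaneSet ∧ φ₁ z ∈ D'.carrier} := by
  ext z
  rw [Set.mem_smul_set_iff_inv_smul_mem₀ (inv_ne_zero hc.ne'), inv_inv]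
  simp only [mem_setOf_eq]
  have hH : z ∈ upperHalfPlaneSet ↔ c • z ∈ upperHalfPlaneSet := by
    rw [← Set.smul_mem_smul_set_iff₀ hc.ne' (A := upperHalfPlaneSet) (x := z), smul_upperHalfPlaneSet hc]
  constructor
  · rintro ⟨hz, hzD⟩
    refine ⟨hH.1 hz, ?_⟩
    rwa [h hz, ConformalEquiv.trans_apply, ConformalEquiv.smulUpperHalfPlane_apply] at hzD
  · rintro ⟨hz, hzD⟩
    have hz' : z ∈ upperHalfPlaneSet := hH.2 hz
    refine ⟨hz', ?_⟩
    rw [h hz', ConformalEquiv.trans_apply, ConformalEquiv.smulUpperHalfPlane_apply]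
    exact hzD

/-- **Pulled-back hulls of two uniformizers differing by a dilation differ by the dilation**:
`closure (ℍ ∖ φ₂⁻¹ D') = c⁻¹ · closure (ℍ ∖ φ₁⁻¹ D')` when `φ₂ = φ₁ ∘ (c ·)` on `ℍ`. [folklore] -/
theorem hull_eq_smul (hc : 0 < c)
    (h : EqOn φ₂ ((ConformalEquiv.smulUpperHalfPlane c hc).trans φ₁) upperHalfPlaneSet) :
    closure (upperHalfPlaneSet \ {z : ℂ | z ∈ upperHalfPlaneSet ∧ φ₂ z ∈ D'.carrier}) =
      c⁻¹ • closure (upperHalfPlaneSet \ {z : ℂ | z ∈ upperHalfPlaneSet ∧ φ₁ z ∈ D'.carrier}) := by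
  have hc' : (c⁻¹ : ℝ) ≠ 0 := inv_ne_zero hc.ne'
  rw [setOf_mem_eq_smul hc h, ← closure_smul₀' hc', Set.smul_set_sdiff₀ hc',
    smul_upperHalfPlaneSet (inv_pos.2 hc)]

end Smul

/-! ### Dilations preserve the side of a hull and the number `Φ'_A(0)` -/

/-- A real point of `c · A` is `c` times a real point of `A`. [folklore] -/
theorem ofReal_mem_smul_iff {A : Set ℂ} {c : ℝ} (hc : c ≠ 0) (x : ℝ) :
    (x : ℂ) ∈ c • A ↔ ((c⁻¹ * x : ℝ) : ℂ) ∈ A := by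
  rw [Set.mem_smul_set_iff_inv_smul_mem₀ hc, Complex.real_smul, Complex.ofReal_mul]

/-- Positive dilations carry minus-hulls to minus-hulls (the `𝒬₋` companion of the tree's
`IsPlusHull.smul`). [folklore] -/
theorem isMinusHull_smul {A : Set ℂ} (hA : IsMinusHull A) {c : ℝ} (hc : 0 < c) : IsMinusHull (c • A) := by
  refine ⟨hA.1.smul hc, fun x hx => ?_⟩
  have h := hA.2 _ ((ofReal_mem_smul_iff hc.ne' x).1 hx)
  have : c * (c⁻¹ * x) < 0 := mul_neg_of_pos_of_neg hc h
  rwa [mul_inv_cancel_left₀ hc.ne'] at this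

/-- **Dilations preserve the side of a hull**: `c · A ∈ 𝒬₊ ↔ A ∈ 𝒬₊` (`c > 0`). [folklore] -/
theorem isPlusHull_smul_iff {A : Set ℂ} {c : ℝ} (hc : 0 < c) : IsPlusHull (c • A) ↔ IsPlusHull A := by
  refine ⟨fun h => ?_, fun h => h.smul hc⟩
  have := h.smul (inv_pos.2 hc)
  rwa [inv_smul_smul₀ hc.ne'] at this

/-- **Dilations preserve the side of a hull**: `c · A ∈ 𝒬₋ ↔ A ∈ 𝒬₋` (`c > 0`). [folklore] -/
theorem isMinusHull_smul_iff {A : Set ℂ} {c : ℝ} (hc : 0 < c) : IsMinusHull (c • A) ↔ IsMinusHull A := by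
  refine ⟨fun h => ?_, fun h => isMinusHull_smul h hc⟩
  have := isMinusHull_smul h (inv_pos.2 hc)
  rwa [inv_smul_smul₀ hc.ne'] at this

/-- **`Φ'_{cA}(0) = Φ'_A(0)` for arbitrary restriction data** ([LSW03] p. 11, "`Φ_{λA}'(0) = Φ_A'(0)` for
`A ∈ 𝒬*`, `λ > 0`"): if `B = c · A` (`A ∈ 𝒬*`, `c > 0`), `(Φ, d)` is ANY restriction datum of `A` and
`(Ψ, e)` ANY restriction datum of `B`, then `e = d` — the transported map `z ↦ c Φ(z/c)` is a restriction
map of `B` with derivative `d` (`HasRestrictionDeriv.smulHull`), restriction maps of the `*`-hull `B` are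
unique on `ℍ ∖ B` (`IsStarHull.existsUnique_isRestrictionMap_holds`), and so is the derivative.
[cite: LawlerSchrammWerner2003Restriction, Prop. 3.3 proof (p. 11)] -/
theorem restrictionDeriv_eq_of_eq_smul {A B : Set ℂ} (hA : IsStarHull A) {c : ℝ} (hc : 0 < c)
    (hB : B = c • A) {Φ : ConformalEquiv (upperHalfPlaneSet \ A) upperHalfPlaneSet}
    {Ψ : ConformalEquiv (upperHalfPlaneSet \ B) upperHalfPlaneSet} {d e : ℝ}
    (hΦ : IsRestrictionMap A Φ) (hd : HasRestrictionDeriv A Φ d)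
    (hΨ : IsRestrictionMap B Ψ) (he : HasRestrictionDeriv B Ψ e) : e = d := by
  subst hB
  have hB : IsStarHull (c • A) := hA.smul hc
  obtain ⟨Φ₀, -, huniq⟩ := IsStarHull.existsUnique_isRestrictionMap_holds hB
  have h1 : EqOn Ψ Φ₀ (upperHalfPlaneSet \ c • A) := huniq Ψ hΨ
  have h2 : EqOn (Φ.smulHull c hc) Φ₀ (upperHalfPlaneSet \ c • A) := huniq _ (hΦ.smulHull hc)
  have hd' : HasRestrictionDeriv (c • A) Ψ d := by
    refine (hd.smulHull hc).congr' ?_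
    filter_upwards [self_mem_nhdsWithin] with z hz
    rw [h2 hz, h1 hz]
  exact he.unique hB hd'

/-! ### The registered stub: the conformal data of the crux are canonical -/

/-- **`stub_datumCanonical` (registered stub of the birth skeleton, lead c4): the conformal data of the
crux are canonical.** For a Dobrushin domain `D`, any `D'`, and two chordal uniformizers `φ₁`, `φ₂` of `D`
such that the pulled-back hull `A₁ = closure (ℍ ∖ φ₁⁻¹ D')` is a `*`-hull: `A₂` is a plus-hull iff `A₁` is,
a minus-hull iff `A₁` is, and ANY restriction data `(Φ₁, d₁)` of `A₁` and `(Φ₂, d₂)` of `A₂` have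
`d₁ = d₂`. (Uniformizers are unique up to dilation, `IsChordalUniformizing.exists_eq_trans_smul_holds`;
everything else is dilation covariance.) So the `∀ (φ, Φ, d)` in the crux body ranges, for each
configuration `(D, D')`, over data with one common side and one common number `d(D, D')`.
[cite: LawlerSchrammWerner2003Restriction, Prop. 3.3 proof (p. 11)] -/
theorem stub_datumCanonical : ∀ (D D' : DobrushinDomain)
    (φ₁ φ₂ : ConformalEquiv upperHalfPlaneSet D.carrier),
    D.IsChordalUniformizing φ₁ → D.IsChordalUniformizing φ₂ →
    IsStarHull (closure (upperHalfPlaneSet \ {z : ℂ | z ∈ upperHalfPlaneSet ∧ φ₁ z ∈ D'.carrier})) →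
    ((IsPlusHull (closure (upperHalfPlaneSet \ {z : ℂ | z ∈ upperHalfPlaneSet ∧ φ₁ z ∈ D'.carrier})) ↔
        IsPlusHull (closure (upperHalfPlaneSet \ {z : ℂ | z ∈ upperHalfPlaneSet ∧ φ₂ z ∈ D'.carrier}))) ∧
      (IsMinusHull (closure (upperHalfPlaneSet \ {z : ℂ | z ∈ upperHalfPlaneSet ∧ φ₁ z ∈ D'.carrier})) ↔
        IsMinusHull (closure (upperHalfPlaneSet \ {z : ℂ | z ∈ upperHalfPlaneSet ∧ φ₂ z ∈ D'.carrier})))) ∧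
    ∀ (Φ₁ : ConformalEquiv (upperHalfPlaneSet \ closure (upperHalfPlaneSet \
        {z : ℂ | z ∈ upperHalfPlaneSet ∧ φ₁ z ∈ D'.carrier})) upperHalfPlaneSet)
      (Φ₂ : ConformalEquiv (upperHalfPlaneSet \ closure (upperHalfPlaneSet \
        {z : ℂ | z ∈ upperHalfPlaneSet ∧ φ₂ z ∈ D'.carrier})) upperHalfPlaneSet) (d₁ d₂ : ℝ),
      IsRestrictionMap (closure (upperHalfPlaneSet \ {z : ℂ | z ∈ upperHalfPlaneSet ∧ φ₁ z ∈ D'.carrier})) Φ₁ →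
      HasRestrictionDeriv (closure (upperHalfPlaneSet \ {z : ℂ | z ∈ upperHalfPlaneSet ∧ φ₁ z ∈ D'.carrier})) Φ₁ d₁ →
      IsRestrictionMap (closure (upperHalfPlaneSet \ {z : ℂ | z ∈ upperHalfPlaneSet ∧ φ₂ z ∈ D'.carrier})) Φ₂ →
      HasRestrictionDeriv (closure (upperHalfPlaneSet \ {z : ℂ | z ∈ upperHalfPlaneSet ∧ φ₂ z ∈ D'.carrier})) Φ₂ d₂ →
      d₁ = d₂ := by
  intro D D' φ₁ φ₂ h₁ h₂ hstar
  obtain ⟨c, hc, hEq⟩ := MarkedDomain.IsChordalUniformizing.exists_eq_trans_smul_holds h₁ h₂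
  have hA := hull_eq_smul (D' := D') hc hEq
  refine ⟨⟨?_, ?_⟩, fun Φ₁ Φ₂ d₁ d₂ hΦ₁ hd₁ hΦ₂ hd₂ => ?_⟩
  · rw [hA, isPlusHull_smul_iff (inv_pos.2 hc)]
  · rw [hA, isMinusHull_smul_iff (inv_pos.2 hc)]
  · exact (restrictionDeriv_eq_of_eq_smul hstar (inv_pos.2 hc) hA hΦ₁ hd₁ hΦ₂ hd₂).symm

/-! ### Consequences for the crux body `OneSidedPowerLawExp α` (part 3) -/

/-- **Transport of the conclusion between data.** If, for one configuration `(D, D', a, b)`, the avoidance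
probabilities tend to `d₁ ^ α` for ONE chordal uniformizer `φ₁` with one-sided pulled-back hull and ONE
restriction datum `(Φ₁, d₁)`, then they tend to `d₂ ^ α` for EVERY uniformizer `φ₂` and every restriction
datum `(Φ₂, d₂)` of its pulled-back hull (which is automatically one-sided, of the same side). [folklore] -/
theorem tendsto_of_tendsto_datum {α : ℝ} {D D' : DobrushinDomain} {p : ℝ → ℝ≥0∞}
    {φ₁ φ₂ : ConformalEquiv upperHalfPlaneSet D.carrier}
    (h₁ : D.IsChordalUniformizing φ₁) (h₂ : D.IsChordalUniformizing φ₂)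
    (hside : IsPlusHull (closure (upperHalfPlaneSet \ {z : ℂ | z ∈ upperHalfPlaneSet ∧ φ₁ z ∈ D'.carrier})) ∨
      IsMinusHull (closure (upperHalfPlaneSet \ {z : ℂ | z ∈ upperHalfPlaneSet ∧ φ₁ z ∈ D'.carrier})))
    {Φ₁ : ConformalEquiv (upperHalfPlaneSet \ closure (upperHalfPlaneSet \
        {z : ℂ | z ∈ upperHalfPlaneSet ∧ φ₁ z ∈ D'.carrier})) upperHalfPlaneSet}
    {Φ₂ : ConformalEquiv (upperHalfPlaneSet \ closure (upperHalfPlaneSet \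
        {z : ℂ | z ∈ upperHalfPlaneSet ∧ φ₂ z ∈ D'.carrier})) upperHalfPlaneSet} {d₁ d₂ : ℝ}
    (hΦ₁ : IsRestrictionMap (closure (upperHalfPlaneSet \ {z : ℂ | z ∈ upperHalfPlaneSet ∧ φ₁ z ∈ D'.carrier})) Φ₁)
    (hd₁ : HasRestrictionDeriv (closure (upperHalfPlaneSet \ {z : ℂ | z ∈ upperHalfPlaneSet ∧ φ₁ z ∈ D'.carrier})) Φ₁ d₁)
    (hΦ₂ : IsRestrictionMap (closure (upperHalfPlaneSet \ {z : ℂ | z ∈ upperHalfPlaneSet ∧ φ₂ z ∈ D'.carrier})) Φ₂)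
    (hd₂ : HasRestrictionDeriv (closure (upperHalfPlaneSet \ {z : ℂ | z ∈ upperHalfPlaneSet ∧ φ₂ z ∈ D'.carrier})) Φ₂ d₂)
    (hT : Tendsto p (𝓝[>] 0) (𝓝 (ENNReal.ofReal (d₁ ^ α)))) :
    Tendsto p (𝓝[>] 0) (𝓝 (ENNReal.ofReal (d₂ ^ α))) := by
  have hstar : IsStarHull (closure (upperHalfPlaneSet \ {z : ℂ | z ∈ upperHalfPlaneSet ∧ φ₁ z ∈ D'.carrier})) :=
    hside.elim (fun h => h.1) (fun h => h.1)
  obtain ⟨-, hd⟩ := stub_datumCanonical D D' φ₁ φ₂ h₁ h₂ hstar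
  rwa [← hd Φ₁ Φ₂ d₁ d₂ hΦ₁ hd₁ hΦ₂ hd₂]

/-- **`∀`-data and `∃`-data forms of the crux body agree.** The right-hand side is the crux body at exponent
`α` with the restriction data quantified EXISTENTIALLY: for every one-sided configuration and uniformizer, SOME
restriction datum `(Φ, d)` of the pulled-back hull has `P_δ[range γ_δ ⊆ closure D'] → d ^ α`.
(`→`: restriction data exist for the `*`-hull, `IsStarHull.existsUnique_isRestrictionMap_holds` and
`IsStarHull.exists_hasRestrictionDeriv_holds`; `←`: canonicity, `stub_datumCanonical` with `φ₁ = φ₂`.)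
The crux itself is `∃ α` of either side (`oneSidedPowerLaw_iff_exists`). [folklore] -/
theorem oneSidedPowerLawExp_iff_exists_datum {α : ℝ} : OneSidedPowerLawExp α ↔
    ∀ (D : DobrushinDomain) (a b : ℝ → Site 2), SAW.IsEndpointApprox D a b →
      ∀ (D' : DobrushinDomain), (D'.carrier ⊆ D.carrier ∧ D'.pt 0 = D.pt 0 ∧ D'.pt 1 = D.pt 1 ∧
        D.pt 0 ∉ closure (D.carrier \ D'.carrier) ∧ D.pt 1 ∉ closure (D.carrier \ D'.carrier)) →
      ∀ (φ : ConformalEquiv upperHalfPlaneSet D.carrier), D.IsChordalUniformizing φ →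
      (IsPlusHull (closure (upperHalfPlaneSet \ {z : ℂ | z ∈ upperHalfPlaneSet ∧ φ z ∈ D'.carrier})) ∨
        IsMinusHull (closure (upperHalfPlaneSet \ {z : ℂ | z ∈ upperHalfPlaneSet ∧ φ z ∈ D'.carrier}))) →
      ∃ (Φ : ConformalEquiv (upperHalfPlaneSet \ closure (upperHalfPlaneSet \
          {z : ℂ | z ∈ upperHalfPlaneSet ∧ φ z ∈ D'.carrier})) upperHalfPlaneSet) (d : ℝ),
        IsRestrictionMap (closure (upperHalfPlaneSet \ {z : ℂ | z ∈ upperHalfPlaneSet ∧ φ z ∈ D'.carrier})) Φ ∧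
        HasRestrictionDeriv (closure (upperHalfPlaneSet \ {z : ℂ | z ∈ upperHalfPlaneSet ∧ φ z ∈ D'.carrier})) Φ d ∧
        Tendsto (fun δ => ((SAW.law D.carrier δ (a δ) (b δ)).map (fun γ => γ.curve))
          (CurveClass.rangeSubset (closure D'.carrier))) (𝓝[>] 0) (𝓝 (ENNReal.ofReal (d ^ α))) := by
  constructor
  · intro h D a b hab D' hsub φ hφ hside
    have hstar : IsStarHull (closure (upperHalfPlaneSet \ {z : ℂ | z ∈ upperHalfPlaneSet ∧ φ z ∈ D'.carrier})) :=
      hside.elim (fun h => h.1) (fun h => h.1)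
    obtain ⟨Φ, hΦ, -⟩ := IsStarHull.existsUnique_isRestrictionMap_holds hstar
    obtain ⟨d, -, -, hd⟩ := IsStarHull.exists_hasRestrictionDeriv_holds hstar hΦ
    exact ⟨Φ, d, hΦ, hd, h D a b hab D' hsub φ hφ hside Φ d hΦ hd⟩
  · intro h D a b hab D' hsub φ hφ hside Φ d hΦ hd
    obtain ⟨Φ₁, d₁, hΦ₁, hd₁, hT⟩ := h D a b hab D' hsub φ hφ hside
    exact tendsto_of_tendsto_datum hφ hφ hside hΦ₁ hd₁ hΦ hd hT

end Summit.CriticalPhenomena.SAWScalingLimit.Theorems.OneSidedPowerLaw.Negative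

end
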